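import Literature.AnabelianGeometry.SemiGraphs.Temperoids
import Literature.AlgebraicGeometry.Frobenioids.BCatOrbits
import Literature.AlgebraicGeometry.Frobenioids.QuasiTemperoidConnected
import Mathlib.GroupTheory.GroupAction.Quotient
import Mathlib.Algebra.Group.Action.Sigma
import HarnessLib

/-!
# [SemiAnbd] Remark 3.1.4: the temperification of `B(Π)` is the connected temperoid `B^temp(Π)`

Mochizuki, *Semi-graphs of anabelioids*, Publ. RIMS **42** (2006) 221–322, §3, manuscript p. 34,
Remark 3.1.4 [cite: MochizukiSemiAnbd2006, Rmk 3.1.4 p.34]: "if `X` is a connected anabelioid, then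
`X^⊤ := (X⁰)^⊤` is a connected temperoid".  For `X = B(Π)`, `Π` profinite, the typed form is the
named fact `TemperificationIsConnectedTemperoid` of
`Literature.AnabelianGeometry.SemiGraphs.Temperoids` (seat abc-iut-L3-t2).

This file DISCHARGES it (abc-iut node `SemiAnbd:Rmk3.1.4`, discharge wave 3) by constructing the
expected chart: the functor

  `Φ : (B(Π)⁰)^⊤ = CountableCoproductCompletion (ConnectedPart (BCat Π)) ⥤ B^temp(Π)`,
  `∐ᵢ Xᵢ ↦ Σ i, Xᵢ` (disjoint union of the underlying finite `Π`-sets),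

is an equivalence of categories for every compact (Hausdorff or not) totally disconnected
topological group `Π` — indeed for the functor and its full faithfulness only a topological group is
needed; compactness enters through "open stabiliser ⇒ finite orbit" in essential surjectivity —
and `Π` itself is tempered (Remark 3.1.1, `IsTempered.of_profinite`).  Ingredients: a morphism out
of a connected (= single-orbit, `BCat.isConnectedObj_iff` of the landed toolkit
`Literature.AlgebraicGeometry.Frobenioids.BCatOrbits`) finite `Π`-set into a disjoint union lands in
one summand (faithful/full); a countable discrete continuous `Π`-set is the countable disjoint union
of its orbits, each finite because its stabilisers are open in the compact group `Π` (essentially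
surjective; Mathlib `MulAction.selfEquivSigmaOrbits'`, `Subgroup.quotient_finite_of_isOpen`).

The equivalence is exposed as a definition (`Temperification.equiv`) for reuse by the
anabelioid/temperoid bridge of [SemiAnbd] §1–§3; the discharge is
`TemperificationIsConnectedTemperoid_holds`.  Plain category theory of `Π`-sets; no statement of the
paper is strengthened.
-/

open CategoryTheory CategoryTheory.Limits Topology
open scoped FintypeCatDiscrete

namespace Literature.AnabelianGeometry.SemiGraphs

open Literature.AlgebraicGeometry.Frobenioids (IsConnectedObj IsNonemptyObj ConnectedPart
  CountableCoproductCompletion BCat)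
open Literature.AlgebraicGeometry.Frobenioids.QuasiTemperoid.BTempConnected (hom_ρ)

universe u

namespace Temperification

variable (G : Type u) [Group G] [TopologicalSpace G]

/-! ### The functor `∐ᵢ Xᵢ ↦ Σ i, Xᵢ` -/

/-- The underlying set of the `Π`-set attached to a formal countable coproduct `∐ᵢ Xᵢ` of connected
finite `Π`-sets: the disjoint union `Σ i, Xᵢ`. [cite: MochizukiSemiAnbd2006, Rmk 3.1.4 p.34] -/
abbrev Carrier (X : temperification.{u} (BCat G)) : Type u :=
  Σ i : X.obj.I, ((X.obj.obj i).obj.obj.V : Type u)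

variable {G}

/-- The action on `Σ i, Xᵢ` is summand-wise: `g · ⟨i, x⟩ = ⟨i, g · x⟩`.
[cite: MochizukiSemiAnbd2006, Rmk 3.1.4 p.34] -/
theorem smul_mk (X : temperification.{u} (BCat G)) (g : G) (i : X.obj.I)
    (x : (X.obj.obj i).obj.obj.V) :
    (g • (⟨i, x⟩ : Carrier G X)) = ⟨i, g • x⟩ :=
  rfl

variable (G) in
/-- `Σ i, Xᵢ` as an object of `B^temp(Π)`: countable (countably many finite summands) with open
stabilisers (those of the finite continuous `Π`-sets `Xᵢ`). [cite: MochizukiSemiAnbd2006, Rmk 3.1.4 p.34] -/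
noncomputable def obj (X : temperification.{u} (BCat G)) : BTemp G :=
  ⟨Action.ofMulAction G (Carrier G X), by
    haveI : Countable X.obj.I := X.property
    refine ⟨inferInstanceAs (Countable (Carrier G X)), fun p => ?_⟩
    obtain ⟨i, x⟩ := p
    have : {g : G | (Action.ofMulAction G (Carrier G X)).ρ g (⟨i, x⟩ : Carrier G X) = ⟨i, x⟩} =
        (MulAction.stabilizer G x : Set G) := by
      ext g
      simp only [Set.mem_setOf_eq, SetLike.mem_coe, MulAction.mem_stabilizer_iff]
      change g • (⟨i, x⟩ : Carrier G X) = ⟨i, x⟩ ↔ g • x = x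
      rw [smul_mk, Sigma.mk.inj_iff]
      exact ⟨fun h => eq_of_heq h.2, fun h => ⟨rfl, heq_of_eq h⟩⟩
    rw [this]
    exact BCat.isOpen_stabilizer _ x⟩

/-- The action on the object `Σ i, Xᵢ` of `B^temp(Π)`, unfolded. [cite: MochizukiSemiAnbd2006, Rmk 3.1.4 p.34] -/
theorem obj_ρ_apply (X : temperification.{u} (BCat G)) (g : G) (p : Carrier G X) :
    (obj G X).obj.ρ g p = g • p := rfl

/-- The functor on morphisms: `(f, (φᵢ)ᵢ) ↦ (⟨i, x⟩ ↦ ⟨f i, φᵢ x⟩)`.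
[cite: MochizukiSemiAnbd2006, Rmk 3.1.4 p.34] -/
noncomputable def map {X Y : temperification.{u} (BCat G)} (f : X ⟶ Y) : obj G X ⟶ obj G Y :=
  ObjectProperty.homMk
    { hom := TypeCat.ofHom fun p : Carrier G X =>
        (⟨f.hom.f p.1, (f.hom.φ p.1).hom.hom.hom p.2⟩ : Carrier G Y)
      comm := fun g => by
        apply ConcreteCategory.hom_ext
        rintro ⟨i, x⟩
        change (⟨f.hom.f i, (f.hom.φ i).hom.hom.hom (g • x)⟩ : Carrier G Y) =
          g • (⟨f.hom.f i, (f.hom.φ i).hom.hom.hom x⟩ : Carrier G Y)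
        rw [smul_mk, BCat.hom_smul] }

/-- The functor on morphisms, on points. [cite: MochizukiSemiAnbd2006, Rmk 3.1.4 p.34] -/
theorem map_apply {X Y : temperification.{u} (BCat G)} (f : X ⟶ Y) (i : X.obj.I)
    (x : (X.obj.obj i).obj.obj.V) :
    ((map f).hom.hom (⟨i, x⟩ : Carrier G X) : Carrier G Y) =
      ⟨f.hom.f i, (f.hom.φ i).hom.hom.hom x⟩ := rfl

variable (G) in
/-- **The temperification functor** `Φ : (B(Π)⁰)^⊤ ⥤ B^temp(Π)`, `∐ᵢ Xᵢ ↦ Σ i, Xᵢ`.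
[cite: MochizukiSemiAnbd2006, Rmk 3.1.4 p.34] -/
noncomputable def functor : temperification.{u} (BCat G) ⥤ BTemp G where
  obj := obj G
  map := map
  map_id X := by
    apply Literature.AlgebraicGeometry.Frobenioids.QuasiTemperoid.BTempConnected.hom_ext_apply
    rintro ⟨i, x⟩
    rfl
  map_comp f g := by
    apply Literature.AlgebraicGeometry.Frobenioids.QuasiTemperoid.BTempConnected.hom_ext_apply
    rintro ⟨i, x⟩
    rfl

/-- The index of a point of `Σ i, Xᵢ` is `Π`-invariant. [cite: MochizukiSemiAnbd2006, Rmk 3.1.4 p.34] -/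
theorem fst_ρ (X : temperification.{u} (BCat G)) (g : G) (p : Carrier G X) :
    ((obj G X).obj.ρ g p).1 = p.1 := by
  obtain ⟨i, x⟩ := p
  rfl

/-- Each summand of an object of `(B(Π)⁰)^⊤` has a point (connected objects are non-initial).
[cite: MochizukiSemiAnbd2006, Rmk 3.1.4 p.34] -/
theorem nonempty_summand (X : temperification.{u} (BCat G)) (i : X.obj.I) :
    Nonempty (X.obj.obj i).obj.obj.V :=
  BCat.nonempty_of_isNonemptyObj _ (X.obj.obj i).property.1

/-- `eqToHom` between summands acts on points as a cast. [cite: MochizukiSemiAnbd2006, Rmk 3.1.4 p.34] -/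
theorem eqToHom_apply {A B : ConnectedPart (BCat G)} (h : A = B) (x : A.obj.obj.V) :
    (eqToHom h).hom.hom.hom x =
      cast (congrArg (fun C : ConnectedPart (BCat G) => ((C.obj.obj.V : Type u))) h) x := by
  subst h
  rfl

/-- Composites of morphisms between summands act as composites on points.
[cite: MochizukiSemiAnbd2006, Rmk 3.1.4 p.34] -/
theorem comp_apply₀ {A B C : ConnectedPart (BCat G)} (k : A ⟶ B) (k' : B ⟶ C) (x : A.obj.obj.V) :
    (k ≫ k').hom.hom.hom x = k'.hom.hom.hom (k.hom.hom.hom x) := rfl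

/-! ### `Φ` is fully faithful -/

variable (G) in
/-- `Φ` is faithful: a morphism `(f, φ)` of formal coproducts is recovered from the map
`⟨i, x⟩ ↦ ⟨f i, φᵢ x⟩` because every summand has a point. [cite: MochizukiSemiAnbd2006, Rmk 3.1.4 p.34] -/
theorem functor_faithful : (functor G).Faithful where
  map_injective := by
    intro X Y f f' h
    have hp : ∀ p : Carrier G X, ((map f).hom.hom p : Carrier G Y) = (map f').hom.hom p := by
      intro p
      change (((functor G).map f).hom.hom p : Carrier G Y) = ((functor G).map f').hom.hom p
      rw [h]
    apply ObjectProperty.hom_ext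
    refine FormalCoproduct.hom_ext (funext fun i => ?_) fun i => ?_
    · obtain ⟨x⟩ := nonempty_summand X i
      exact congrArg Sigma.fst (hp ⟨i, x⟩)
    · apply ObjectProperty.hom_ext
      apply BCat.hom_ext_apply
      intro x
      obtain ⟨-, e2⟩ := Sigma.mk.inj_iff.mp (hp ⟨i, x⟩)
      rw [comp_apply₀, eqToHom_apply]
      exact (cast_eq_iff_heq).mpr e2

/-- `Φ` is full: a `Π`-map `Σ i, Xᵢ → Σ j, Yⱼ` sends each (transitive) summand `Xᵢ` into a single
summand `Y_{f i}`, by `Π`-maps `φᵢ`. [cite: MochizukiSemiAnbd2006, Rmk 3.1.4 p.34] -/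
theorem functor_full [IsTopologicalGroup G] : (functor G).Full where
  map_surjective := by
    intro X Y F
    classical
    let x₀ : ∀ i, (X.obj.obj i).obj.obj.V := fun i => Classical.choice (nonempty_summand X i)
    let idx : X.obj.I → Y.obj.I := fun i => ((F.hom.hom (⟨i, x₀ i⟩ : Carrier G X) : Carrier G Y)).1
    have htr : ∀ (i) (x : (X.obj.obj i).obj.obj.V), ∃ g : G, g • x₀ i = x := fun i x =>
      BCat.exists_smul_eq_of_isConnectedObj _ (X.obj.obj i).property (x₀ i) x
    have hidx : ∀ (i) (x : (X.obj.obj i).obj.obj.V),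
        ((F.hom.hom (⟨i, x⟩ : Carrier G X) : Carrier G Y)).1 = idx i := by
      intro i x
      obtain ⟨g, rfl⟩ := htr i x
      have e := hom_ρ F g (⟨i, x₀ i⟩ : Carrier G X)
      change (F.hom.hom (⟨i, g • x₀ i⟩ : Carrier G X) : Carrier G Y) =
        (obj G Y).obj.ρ g (F.hom.hom (⟨i, x₀ i⟩ : Carrier G X)) at e
      rw [e]
      exact fst_ρ Y g _
    let comp : ∀ i, (X.obj.obj i).obj.obj.V → (Y.obj.obj (idx i)).obj.obj.V := fun i x =>
      cast (congrArg (fun j => ((Y.obj.obj j).obj.obj.V : Type u)) (hidx i x))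
        ((F.hom.hom (⟨i, x⟩ : Carrier G X) : Carrier G Y)).2
    have hF : ∀ (i) (x : (X.obj.obj i).obj.obj.V),
        (F.hom.hom (⟨i, x⟩ : Carrier G X) : Carrier G Y) = ⟨idx i, comp i x⟩ := fun i x =>
      Sigma.ext (hidx i x) (cast_heq _ _).symm
    have hcomp : ∀ (i) (g : G) (x : (X.obj.obj i).obj.obj.V), comp i (g • x) = g • comp i x := by
      intro i g x
      have e := hom_ρ F g (⟨i, x⟩ : Carrier G X)
      change (F.hom.hom (⟨i, g • x⟩ : Carrier G X) : Carrier G Y) =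
        (obj G Y).obj.ρ g (F.hom.hom (⟨i, x⟩ : Carrier G X)) at e
      rw [hF, hF, obj_ρ_apply, smul_mk] at e
      exact eq_of_heq (Sigma.mk.inj_iff.mp e).2
    let φ : ∀ i, X.obj.obj i ⟶ Y.obj.obj (idx i) := fun i =>
      ObjectProperty.homMk (ObjectProperty.homMk
        { hom := FintypeCat.homMk (comp i)
          comm := fun g => by
            apply FintypeCat.hom_ext
            intro x
            simp only [FintypeCat.comp_apply, FintypeCat.homMk_apply]
            change comp i (g • x) = g • comp i x
            exact hcomp i g x })
    refine ⟨ObjectProperty.homMk { f := idx, φ := φ }, ?_⟩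
    apply Literature.AlgebraicGeometry.Frobenioids.QuasiTemperoid.BTempConnected.hom_ext_apply
    rintro ⟨i, x⟩
    change ((map _).hom.hom (⟨i, x⟩ : Carrier G X) : Carrier G Y) = F.hom.hom ⟨i, x⟩
    rw [map_apply, hF]
    rfl

/-! ### `Φ` is essentially surjective (for compact `Π`) -/

/-- `Φ` is essentially surjective when `Π` is compact: a countable discrete continuous `Π`-set is
the countable disjoint union of its orbits, each a finite (open stabiliser of finite index)
transitive continuous `Π`-set, i.e. a connected object of `B(Π)`.
[cite: MochizukiSemiAnbd2006, Rmk 3.1.4 p.34] -/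
theorem functor_essSurj [IsTopologicalGroup G] [CompactSpace G] : (functor G).EssSurj where
  mem_essImage Y := by
    classical
    letI : MulAction G Y.obj.V := Action.instMulAction Y.obj
    haveI : Countable Y.obj.V := Y.property.1
    have hstab : ∀ y : Y.obj.V, IsOpen (MulAction.stabilizer G y : Set G) := fun y => by
      have : (MulAction.stabilizer G y : Set G) = {g : G | Y.obj.ρ g y = y} := by
        ext g
        simp only [SetLike.mem_coe, MulAction.mem_stabilizer_iff, Set.mem_setOf_eq]
        rfl
      rw [this]
      exact Y.property.2 y
    -- the orbits `ω`, their point sets `O ω ⊆ Y`, the class `cl y` of a point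
    let Ω : Type u := MulAction.orbitRel.Quotient G Y.obj.V
    let O : Ω → Set Y.obj.V := fun ω => MulAction.orbitRel.Quotient.orbit ω
    let cl : Y.obj.V → Ω := fun y => (Quotient.mk'' y : MulAction.orbitRel.Quotient G Y.obj.V)
    have hmem : ∀ (y : Y.obj.V) (ω : Ω), y ∈ O ω ↔ cl y = ω := fun y ω =>
      MulAction.orbitRel.Quotient.mem_orbit
    have hcl : ∀ (g : G) (y : Y.obj.V), cl (g • y) = cl y := fun g y =>
      Quotient.sound' (MulAction.mem_orbit y g)
    have hfin : ∀ ω : Ω, Finite (O ω) := by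
      intro ω
      change Finite (MulAction.orbitRel.Quotient.orbit ω)
      rw [MulAction.orbitRel.Quotient.orbit_eq_orbit_out ω Quotient.out_eq']
      haveI := Subgroup.quotient_finite_of_isOpen _ (hstab ω.out)
      exact Finite.of_equiv _ (MulAction.orbitEquivQuotientStabilizer G _).symm
    -- the summands: the orbits, as finite continuous transitive `Π`-sets
    let A : Ω → Action FintypeCat.{u} G := fun ω =>
      Action.FintypeCat.ofMulAction G (@FintypeCat.of (O ω) (hfin ω))
    have hA : ∀ ω, Action.IsContinuous (A ω) := by
      intro ω
      rw [BCat.isContinuous_iff]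
      intro a
      suffices h : (MulAction.stabilizer G a : Set G) =
          MulAction.stabilizer G ((show O ω from a) : Y.obj.V) by
        rw [h]
        exact hstab _
      ext g
      simp only [SetLike.mem_coe, MulAction.mem_stabilizer_iff]
      exact Subtype.ext_iff
    have hconn : ∀ ω, IsConnectedObj (⟨A ω, hA ω⟩ : BCat G) := by
      intro ω
      have ha : ω.out ∈ O ω := (hmem _ _).mpr ω.out_eq'
      refine BCat.isConnectedObj_of_transitive _ (show (A ω).V from (⟨ω.out, ha⟩ : O ω)) fun b => ?_
      obtain ⟨g, hg⟩ := MulAction.exists_smul_eq G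
        (⟨ω.out, ha⟩ : MulAction.orbitRel.Quotient.orbit ω)
        (show ↥(MulAction.orbitRel.Quotient.orbit ω) from b)
      exact ⟨g, hg⟩
    let X₀ : temperification.{u} (BCat G) :=
      ⟨⟨Ω, fun ω => ⟨⟨A ω, hA ω⟩, hconn ω⟩⟩,
        inferInstanceAs (Countable (MulAction.orbitRel.Quotient G Y.obj.V))⟩
    -- the comparison maps `⟨ω, a⟩ ↦ a` and `y ↦ ⟨cl y, y⟩`
    let fwd : Carrier G X₀ → Y.obj.V := fun p => ((show O p.1 from p.2) : Y.obj.V)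
    let bwd : Y.obj.V → Carrier G X₀ := fun y =>
      ⟨cl y, show (A (cl y)).V from (⟨y, (hmem y (cl y)).mpr rfl⟩ : O (cl y))⟩
    have hfb : ∀ y, fwd (bwd y) = y := fun y => rfl
    have hbf : ∀ p, bwd (fwd p) = p := by
      rintro ⟨ω, a⟩
      change (⟨cl ((show O ω from a) : Y.obj.V), _⟩ : Σ ω' : Ω, O ω') = ⟨ω, show O ω from a⟩
      refine Sigma.subtype_ext ?_ rfl
      exact (hmem _ _).mp (show O ω from a).2
    have hfwd_smul : ∀ (g : G) (p : Carrier G X₀), fwd (g • p) = g • fwd p := by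
      rintro g ⟨ω, a⟩
      rfl
    have hbwd_smul : ∀ (g : G) (y : Y.obj.V), bwd (g • y) = g • bwd y := by
      intro g y
      change (⟨cl (g • y), ⟨g • y, _⟩⟩ : Σ ω' : Ω, O ω') = ⟨cl y, ⟨g • y, _⟩⟩
      exact Sigma.subtype_ext (hcl g y) rfl
    let e₁ : obj G X₀ ⟶ Y := ObjectProperty.homMk
      { hom := TypeCat.ofHom fwd
        comm := fun g => by
          apply ConcreteCategory.hom_ext
          intro p
          exact hfwd_smul g p }
    let e₂ : Y ⟶ obj G X₀ := ObjectProperty.homMk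
      { hom := TypeCat.ofHom bwd
        comm := fun g => by
          apply ConcreteCategory.hom_ext
          intro y
          exact hbwd_smul g y }
    refine ⟨X₀, ⟨⟨e₁, e₂, ?_, ?_⟩⟩⟩
    · apply Literature.AlgebraicGeometry.Frobenioids.QuasiTemperoid.BTempConnected.hom_ext_apply
      intro p
      exact hbf p
    · apply Literature.AlgebraicGeometry.Frobenioids.QuasiTemperoid.BTempConnected.hom_ext_apply
      intro y
      exact hfb y

/-! ### The equivalence and the discharge of Remark 3.1.4 -/

/-- For compact `Π`, the temperification functor `Φ : (B(Π)⁰)^⊤ ⥤ B^temp(Π)` is an equivalence.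
[cite: MochizukiSemiAnbd2006, Rmk 3.1.4 p.34] -/
theorem functor_isEquivalence [IsTopologicalGroup G] [CompactSpace G] :
    (functor G).IsEquivalence :=
  haveI := functor_faithful G
  haveI := functor_full (G := G)
  haveI := functor_essSurj (G := G)
  { }

variable (G) in
/-- **The temperification equivalence** `(B(Π)⁰)^⊤ ≌ B^temp(Π)` for a compact topological group `Π`
(countable formal coproducts of connected finite continuous `Π`-sets ≃ countable discrete
continuous `Π`-sets). [cite: MochizukiSemiAnbd2006, Rmk 3.1.4 p.34] -/
noncomputable def equiv [IsTopologicalGroup G] [CompactSpace G] :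
    temperification.{u} (BCat G) ≌ BTemp G :=
  haveI := functor_isEquivalence (G := G)
  (functor G).asEquivalence

end Temperification

/-- **[SemiAnbd] Remark 3.1.4 — DISCHARGED** (named fact `TemperificationIsConnectedTemperoid` of
`Temperoids.lean`): for `Π` profinite (compact, totally disconnected), the temperification
`(B(Π)⁰)^⊤` is a connected temperoid, with tempered fundamental group `Π` itself
(Remark 3.1.1: profinite groups are tempered). [cite: MochizukiSemiAnbd2006, Rmk 3.1.4 p.34] -/
theorem TemperificationIsConnectedTemperoid_holds : TemperificationIsConnectedTemperoid.{u} := by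
  intro G _ _ _ _ _
  exact ⟨{ G := G, isTempered := IsTempered.of_profinite, equiv := Temperification.equiv G }⟩

end Literature.AnabelianGeometry.SemiGraphs
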